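import Literature.Analysis.Calculus.NestedJets
import Literature.MathematicalPhysics.QuantumFieldTheory.Balaban1983to89.B1Eq361Proof

/-!
# `Balaban1983to89.B1Eq363JetProof` — T. Bałaban, *(Higgs)₂,₃ quantum fields in a finite volume. I. A lower bound*,
Commun. Math. Phys. **85** (1982) 603–626 [Balaban1982Higgs1]: the step **(3.62) ⇒ (3.63)**, p. 624 — *"Now let us
notice that in (3.61) we can take a whole function E_k instead of its expansion until the order n̄"* — PROVED as the
`n̄`-JET STATEMENT it is: the perturbative sum (3.62) `Σ_{0≦α+β≦n̄} (1/(α!β!)) e^αλ^β ∂^{α+β}E/∂e′^α∂λ′^β|₀` of the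
generating function `E` of (3.61) (`B1Eq361Proof.genFn361`, whose exponent is the order-`n̄` Taylor expansion of
`E_k` in the couplings) EQUALS the same sum for the generating function with the whole `E_k` in the exponent, under
displayed hypotheses making the author's *"Analyzing carefully the successive steps"* precise (differentiation under
the two integral signs up to order `n̄` at zero couplings; smoothness and non-vanishing of the two integrals)

statement-level skeleton of published theorems with citation tags; proofs where landed; nothing here is a claim about the Yang–Mills mass gap

PDF held: `paper:balaban1982-cmp85-higgs23-i` (journal page = PDF page + 602); pp. 623–624 READ AS IMAGES on the x2 renders
`run/shared/lean/pub/pub-balaban/b2b-balaban-ref1/pages/1982-cmp85-higgs23-I/…-p021-x2.png`, `…-p022-x2.png`; (3.35)/(3.36)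
p. 618 `…-p016-x2.png`.

CITATION HEADER (lean-in-tree rule).  WHAT IS REPRODUCED — SKELETON row **B1.Eq3.62–3.63** of reader r12
(`lit-balaban-r12/ROWS-B1-part2.md`: «(3.62)–(3.63) p. 624; typed p239973 (`B1Sect3Statements.pertSum362`, `Step363`) ·
(3.63)+(3.65) ⇒ (3.36)_{k+1} proved p244846 (`B1Step363Proof.step363_of_eq365`)»; r14's umbrella row B1.Eq3.60), the member
left open by the earlier files of this seat (`B1Eq361Proof` module docstring, HONEST SCOPE (iii): *"(3.62) ⇒ (3.63) … is an
n̄-jet statement under the integral sign and is not treated"*).  Verbatim, p. 624 [PDF 22]: *"Analyzing carefully the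
successive steps we get the following perturbative formula
S^{(k+1),L^{k+1}ε}(B, ψ) = Σ_{0≦α+β≦n̄} (1/(α!β!)) e^αλ^β (∂^{α+β}/∂e′^α∂λ′^β E(e′, λ′, B, ψ))|_{e′=λ′=0}. (3.62)
Now let us notice that in (3.61) we can take a whole function E_k instead of its expansion until the order n̄, so
S^{(k+1),L^{k+1}ε}(B, ψ) = Σ_{0≦α+β≦n̄} (1/(α!β!)) e^αλ^β (∂^{α+β}/∂e′^α∂λ′^β E′(e′, λ′, B, ψ))|_{e′=λ′=0}, (3.63) where
E′(e′, λ′, B, ψ) = ½⟨B, Δ^{(k+1),L^{k+1}ε}B⟩ − log[Π_{j=0}^{k} (…) ∫dA′_j exp(−½⟨A′_j, (C^{(j),L^jε})⁻¹A′_j⟩)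
T^{L^kε}_{a,L,eB^{(k+1)ε}+e′A′^{(k)ε}}[T^ε_{a_k,L^k,eB^{(k+1)ε}+e′Σ_{j=0}^{k}A′^{(j)ε}}[exp[…]]]]. (3.64)"*; p. 623 [PDF 21], the
display (3.61) (= the second display numbered (3.60)): *"E(e′, λ′, B, ψ) = … = ½⟨B, Δ^{(k+1),L^{k+1}ε}B⟩ − log[(…)∫dA′_k
exp(−½⟨A′_k,(C^{(k),L^kε})⁻¹A′_k⟩)·T^{L^kε}_{a,L,eB^{(k+1)ε}+e′A′^{(k)ε}}[exp[−Σ_{0≦α+β≦n}(1/(α!β!))e′^αλ′^β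
(∂^{α+β}/∂e″^α∂λ″^β E_k(e″, λ″, eB^{(k+1)ε} + e′A′^{(k)ε}, φ))|_{e″=λ″=0}]]]"*.

THE MATHEMATICS OF THE SENTENCE.  In (3.61) the exponent under `T[…]` is, for fixed fields, the function
`F(e′, λ′) = Σ_{α+β≦n̄} (1/(α!β!)) e′^αλ′^β ∂^α_s∂^β_t K(e′, 0, 0)`, where `K(u, s, t) = E_k(s, t, eB^{(k+1)ε} + uA′^{(k)ε}, φ)`
— the coupling `e′` enters TWICE: through the background (`u`) and as the Taylor variable (`s`).  *"A whole function E_k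
instead of its expansion"* is `G(e′, λ′) = K(e′, e′, λ′)` (the diagonal `u = s = e′`; this is why (3.64) carries the single
background `eB^{(k+1)ε} + e′Σ_{j=0}^{k}A′^{(j)ε}`).  The perturbative sums (3.62)/(3.63) only see the derivatives
`∂^a_{e′}∂^b_{λ′}(·)|₀` with `a + b ≦ n̄` (the nested `n̄`-jet), and:
(A) `F` and `G` have the same nested `n̄`-jet at `0` — Taylor expansion in `s` along the diagonal `u = s`
(`Literature.Analysis.Calculus.NestedJet.iteratedDeriv_diag_eq_taylorSum`: Hörmander I (1.1.7)′, Thm 1.1.8) after the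
`λ′`-derivative has been taken on the Taylor polynomial (`iteratedDeriv_pertSum362_snd`) — this is `jet_taylor_diag`;
(B) equal nested `n̄`-jets pass through `x ↦ exp(−x)`, through the product with the kernel `t(e′; ψ, φ)`, and — GIVEN that
the derivatives up to order `n̄` at zero couplings may be taken under the two integral signs `∫dνA ∫dφ` — through the two
integrals, then through `x ↦ ½⟨B,ΔB⟩ − log x` away from `0` (`NestedJet.comp`/`NestedJet.mul`: Dieudonné IV (19.5.1), (19.5.5));
(C) hence `pertSum362 E = pertSum362 E′` (`eq362_363`), i.e. (3.62) ⇒ (3.63) (`eq363_of_eq362`).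

THE TYPING (as in `B1Eq361Proof`/`B1Eq365Proof`, schematic where the paper's objects are built elsewhere, CONCRETE in the
transformation structure): `V` ↤ `ℝ^N`; `X` ↤ the fine sites (field `φ : X → V`, integrated inside `B1RT.rtOp` (2.4) against
Lebesgue measure); `Y` ↤ the block sites (`ψ : Y → V`); `(ΩA, νA)` ↤ the fluctuation field `A′_k` with its weighted Gaussian
measure (any measure space); `t₁ e′ a` ↤ the kernel (2.5) of `T^{L^kε}_{a,L,eB^{(k+1)ε}+e′A′^{(k)ε}}` (depends on the
coupling `e′` and the point `a = A′_k`); `Ek e′ a φ : ℝ → ℝ → ℝ` ↤ `(e″, λ″) ↦ E_k(e″, λ″, eB^{(k+1)ε}+e′A′^{(k)ε}, φ)`;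
`nbar` ↤ `n̄` (the order `n` printed in (3.61) is read as `n̄`, as (3.62) requires); `quadB` ↤ `⟨B, Δ^{(k+1),L^{k+1}ε}B⟩`.
The function `E′` of the conclusion is (3.61) with the whole `E_k` in the exponent; the printed (3.64) is this expression
after `E_k` is replaced by its definition (3.35) (`exp(−E_k) =` the normalised fluctuation integral, `B1Eq365Proof.genFn335`)
and the fluctuation integrals are merged — the shape `B1Eq365Proof.genFn364`, not re-derived here.

WHAT THIS FILE PROVES (theorems only, 0 `sorry`, standard axioms):
* `iteratedDeriv_pertSum362_snd` — the `b`-th `λ′`-derivative at `0` of `λ′ ↦ pertSum362 E e λ′ n̄` is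
  `Σ_{α≦n̄−b} e^α/α! · ∂^α_{e′}∂^b_{λ′}E|₀` (`b ≦ n̄`);
* `contDiff_pertSum362` — the exponent of (3.61) is jointly smooth in `(e′, λ′)` when `E_k` is jointly smooth;
* **`jet_taylor_diag`** — (A): `∂^a_u∂^b_t [pertSum362 (K u) u t n̄]|₀ = ∂^a_u∂^b_t [K u u t]|₀` for `a + b ≦ n̄`;
* `pertSum362_congr_jet` — `pertSum362` depends only on the nested `n̄`-jet;
* `integrand_jet_eq` — (B) pointwise in `(a, φ)`: the integrands `t₁·exp(−F)` and `t₁·exp(−G)` have equal nested `n̄`-jets;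
* **`eq362_363`** — (C): `pertSum362 (genFn361 quadB νA t₁ Ek n̄ ψ) e λ n̄ = pertSum362 E′ e λ n̄`, `E′ e′ λ′ = ½quadB −
  log ∫ T_{t₁(e′,a)}[φ ↦ exp(−E_k(e′, λ′; e′, a, φ))](ψ) dνA(a)`, under the displayed hypotheses (a)–(d) below;
* `eq363_of_eq362` — the printed implication: `S^{(k+1)} = (3.62) ⇒ S^{(k+1)} = (3.63)`.
HONEST SCOPE.  Hypotheses of `eq362_363`, all displayed: (a) `E_k(s, t, eB + uA′, φ)` jointly `C^∞` in `(u, s, t)` for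
every `(a, φ)`; (b) the kernel `t₁ e′ a ψ φ` smooth in `e′`; (c) the two `dνA`-integrals (with the expanded and with the
whole `E_k`) are `C^∞` functions of `(e′, λ′)` on `ℝ²` and never `0` (the author's own caveat, p. 624: *"the formula is
not well defined … we can give a sense to this formula introducing the corresponding characteristic functions …"* — no
convergence is proved here); (d) for `a + b ≦ n̄` the nested derivative `∂^a_{e′}∂^b_{λ′}(·)|₀` of each of the two
integrals equals the `∫dνA ∫dφ` integral of the nested derivative of its integrand (differentiation under the integral
signs = *"Analyzing carefully the successive steps"*).  Global-in-the-couplings smoothness is assumed for convenience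
although only germs at `0` matter.  Nothing here asserts (3.26) or any bound.
Unit `lit-balaban-p14` gen 4 (Phase-2 proof seat p14, literature-prover-lit-balaban-p14-g4-0), HOME `run/shared/lean/pub/lit-balaban/`
(seat log `lit-balaban-p14/STATUS.md`); calculus in `Literature/Analysis/Calculus/NestedJets.lean` (same seat).
-/

open scoped ContDiff BigOperators
open _root_.MeasureTheory Finset

namespace Literature.MathematicalPhysics.QuantumFieldTheory.Balaban1983to89.B1Eq363JetProof

open Literature.MathematicalPhysics.QuantumFieldTheory.Balaban1983to89
open Literature.Analysis.Calculus
open B1RT B1Sect3Statements B1Eq361Proof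

/-- `n ≤ ∞` for a natural number `n` (exponent bookkeeping). [folklore] -/
private theorem natCast_le_infty (n : ℕ) : (n : ℕ∞ω) ≤ ∞ := mod_cast le_top

/-- Derivatives at `0` of a monomial `λ′ ↦ A·λ′^β·B`. [folklore] -/
private theorem iteratedDeriv_monomial (A B : ℝ) (β b : ℕ) :
    iteratedDeriv b (fun l : ℝ => A * l ^ β * B) 0 = if b = β then A * B * (β.factorial : ℝ) else 0 := by
  have h : (fun l : ℝ => A * l ^ β * B) = fun l => (A * B) * l ^ β := by
    funext l
    ring
  rw [h, iteratedDeriv_const_mul_field, iteratedDeriv_fun_pow_zero]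
  split_ifs <;> ring

/-! ## §1 The `λ′`-derivatives of the perturbative sum (3.62), and its smoothness in the couplings -/

section StepOne

/-- **The `λ′`-derivatives of (3.62) at zero coupling.**  For `b ≦ n̄`, the `b`-th derivative at `λ′ = 0` of
`λ′ ↦ Σ_{0≦α+β≦n̄} (1/(α!β!)) e^αλ′^β ∂^α_{e′}∂^β_{λ′}E|₀` is `Σ_{α≦n̄−b} e^α/α! · ∂^α_{e′}∂^b_{λ′}E|₀` (only the monomials
`λ′^b` survive). [cite: Balaban1982Higgs1, (3.62) p.624] -/
theorem iteratedDeriv_pertSum362_snd (E : ℝ → ℝ → ℝ) (e : ℝ) {nbar b : ℕ} (hb : b ≤ nbar) :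
    iteratedDeriv b (fun l => pertSum362 E e l nbar) 0
      = ∑ α ∈ range (nbar - b + 1), e ^ α / (α.factorial : ℝ)
          * iteratedDeriv α (fun e' => iteratedDeriv b (fun l' => E e' l') 0) 0 := by
  unfold pertSum362
  rw [iteratedDeriv_fun_sum fun ab _ => by
    exact ((contDiff_const.mul (contDiff_id.pow _)).mul contDiff_const).contDiffAt]
  simp_rw [iteratedDeriv_monomial]
  rw [sum_filter, sum_product]
  have hinner : ∀ α ∈ range (nbar + 1),
      (∑ β ∈ range (nbar + 1), if α + β ≤ nbar then
        (if b = β then 1 / ((α.factorial : ℝ) * (β.factorial : ℝ)) * e ^ α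
          * iteratedDeriv α (fun e' => iteratedDeriv β (fun l' => E e' l') 0) 0 * (β.factorial : ℝ)
          else 0) else 0)
      = if α + b ≤ nbar then e ^ α / (α.factorial : ℝ)
          * iteratedDeriv α (fun e' => iteratedDeriv b (fun l' => E e' l') 0) 0 else 0 := by
    intro α _
    have hswap : ∀ β ∈ range (nbar + 1), (if α + β ≤ nbar then
        (if b = β then 1 / ((α.factorial : ℝ) * (β.factorial : ℝ)) * e ^ α
          * iteratedDeriv α (fun e' => iteratedDeriv β (fun l' => E e' l') 0) 0 * (β.factorial : ℝ)
          else 0) else 0)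
        = if b = β then (if α + β ≤ nbar then e ^ α / (α.factorial : ℝ)
          * iteratedDeriv α (fun e' => iteratedDeriv β (fun l' => E e' l') 0) 0 else 0) else 0 := by
      intro β _
      have hβ : (β.factorial : ℝ) ≠ 0 := by positivity
      have hα : (α.factorial : ℝ) ≠ 0 := by positivity
      split_ifs <;> first | rfl | field_simp
    rw [sum_congr rfl hswap, sum_ite_eq]
    simp [Nat.lt_succ_of_le hb]
  rw [sum_congr rfl hinner, ← sum_filter]
  congr 1
  ext α
  simp only [mem_filter, mem_range]
  omega

/-- **The exponent of (3.61) is jointly smooth in the couplings**: for `K(u, s, t)` jointly `C^∞` (`K` ↤ `(u, s, t) ↦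
E_k(s, t, eB^{(k+1)ε} + uA′^{(k)ε}, φ)` at fixed fields), `(e′, λ′) ↦ Σ_{α+β≦n̄} (1/(α!β!)) e′^αλ′^β ∂^α_s∂^β_tK(e′,0,0)`
is `C^∞` (the coefficients are iterated partial derivatives of a smooth function, `NestedJet.contDiff_iteratedDeriv_snd_comp`).
[cite: Balaban1982Higgs1, (3.61)–(3.62) pp.623–624] -/
theorem contDiff_pertSum362 (K : ℝ → ℝ → ℝ → ℝ)
    (hK : ContDiff ℝ ∞ (fun p : ℝ × ℝ × ℝ => K p.1 p.2.1 p.2.2)) (nbar : ℕ) :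
    ContDiff ℝ ∞ (Function.uncurry fun u t => pertSum362 (K u) u t nbar) := by
  have hK2 : ContDiff ℝ ∞ (Function.uncurry fun (p : ℝ × ℝ) (t : ℝ) => K p.1 p.2 t) :=
    hK.comp ((contDiff_fst.comp contDiff_fst).prodMk
      ((contDiff_snd.comp contDiff_fst).prodMk contDiff_snd))
  unfold pertSum362
  refine ContDiff.sum fun ab _ => ?_
  refine ((contDiff_const.mul (contDiff_fst.pow _)).mul (contDiff_snd.pow _)).mul ?_
  have hN : ContDiff ℝ ∞ (Function.uncurry fun u s => iteratedDeriv ab.2 (K u s) 0) :=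
    NestedJet.contDiff_iteratedDeriv_snd_comp hK2 ab.2 contDiff_const
  exact (NestedJet.contDiff_iteratedDeriv_snd_comp hN ab.1 contDiff_const).comp contDiff_fst

end StepOne

/-! ## §2 (A) The jet identity: the expansion of `E_k` and the whole `E_k` have the same nested `n̄`-jet -/

section JetIdentity

/-- **(A) — "we can take a whole function E_k instead of its expansion until the order n̄".**  For
`K(u, s, t)` jointly `C^∞`, the exponent of (3.61), `F(u, t′) = pertSum362 (K u) u t′ n̄ = Σ_{α+β≦n̄} (1/(α!β!))
u^αt′^β ∂^α_s∂^β_t K(u, 0, 0)`, and the whole function on the diagonal, `G(u, t′) = K(u, u, t′)`, have the same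
nested derivatives `∂^a_u ∂^b_{t′}(·)|₀` for all `a + b ≦ n̄`.  Proof: the `t′`-derivative of the Taylor polynomial
(`iteratedDeriv_pertSum362_snd`) leaves `Σ_{α≦n̄−b} u^α/α! ∂^α_s N(u, 0)` with `N(u, s) = ∂^b_t K(u, s, 0)`, and
`∂^b_{t′}G(u, 0) = N(u, u)`; then Taylor's formula in `s` along the diagonal
(`NestedJet.iteratedDeriv_diag_eq_taylorSum`, which uses the symmetry `∂_u∂^α_s = ∂^α_s∂_u`).
[cite: Balaban1982Higgs1, (3.62)–(3.63) p.624] -/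
theorem jet_taylor_diag (K : ℝ → ℝ → ℝ → ℝ)
    (hK : ContDiff ℝ ∞ (fun p : ℝ × ℝ × ℝ => K p.1 p.2.1 p.2.2)) (nbar : ℕ) {a b : ℕ}
    (hab : a + b ≤ nbar) :
    iteratedDeriv a (fun u => iteratedDeriv b (fun t => pertSum362 (K u) u t nbar) 0) 0
      = iteratedDeriv a (fun u => iteratedDeriv b (fun t => K u u t) 0) 0 := by
  have hK2 : ContDiff ℝ ∞ (Function.uncurry fun (p : ℝ × ℝ) (t : ℝ) => K p.1 p.2 t) :=
    hK.comp ((contDiff_fst.comp contDiff_fst).prodMk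
      ((contDiff_snd.comp contDiff_fst).prodMk contDiff_snd))
  have hN : ContDiff ℝ ∞ (Function.uncurry fun u s => iteratedDeriv b (K u s) 0) :=
    NestedJet.contDiff_iteratedDeriv_snd_comp hK2 b contDiff_const
  have h1 : (fun u => iteratedDeriv b (fun t => pertSum362 (K u) u t nbar) 0)
      = fun u => ∑ α ∈ range (nbar - b + 1), u ^ α / (α.factorial : ℝ)
          * iteratedDeriv α (fun s => iteratedDeriv b (K u s) 0) 0 := by
    funext u
    exact iteratedDeriv_pertSum362_snd (K u) u (by omega)
  rw [h1]
  exact (NestedJet.iteratedDeriv_diag_eq_taylorSum hN (a := a) (M := nbar - b + 1) (by omega)).symm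

/-- **The perturbative sum (3.62) only sees the nested `n̄`-jet**: generating functions with the same
`∂^a_{e′}∂^b_{λ′}(·)|₀`, `a + b ≦ n̄`, have the same `pertSum362`. [cite: Balaban1982Higgs1, (3.62) p.624] -/
theorem pertSum362_congr_jet {E₁ E₂ : ℝ → ℝ → ℝ} {nbar : ℕ}
    (h : ∀ a b, a + b ≤ nbar → iteratedDeriv a (fun u => iteratedDeriv b (fun s => E₁ u s) 0) 0
      = iteratedDeriv a (fun u => iteratedDeriv b (fun s => E₂ u s) 0) 0) (e lam : ℝ) :
    pertSum362 E₁ e lam nbar = pertSum362 E₂ e lam nbar := by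
  unfold pertSum362
  refine sum_congr rfl fun ab hab => ?_
  rw [h ab.1 ab.2 (by simpa using (mem_filter.mp hab).2)]

end JetIdentity

/-! ## §3 (B)–(C) Through `exp`, the kernel, the two integrals and `−log`: (3.62) = (3.63) -/

section Assembly

/-- **(B), pointwise in the fluctuation configuration `a` and the fine field `φ`**: the integrands of the
(2.4)-integral `T_{t₁}[·]` in (3.61) and in (3.63) — the kernel value times `exp(−F)`, resp. `exp(−G)` — have the same
nested derivatives `∂^a_{e′}∂^b_{λ′}(·)|₀` for `a + b ≦ n̄` (from `jet_taylor_diag` through `x ↦ exp(−x)` and the product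
with the `e′`-dependent kernel, `NestedJet.comp`/`NestedJet.mul`). [cite: Balaban1982Higgs1, (3.62)–(3.63) p.624] -/
theorem integrand_jet_eq {ΩA Φ : Type*} (t : ℝ → ΩA → Φ → ℝ) (Ek : ℝ → ΩA → Φ → ℝ → ℝ → ℝ) (nbar : ℕ)
    (a' : ΩA) (φ : Φ) (hK : ContDiff ℝ ∞ (fun p : ℝ × ℝ × ℝ => Ek p.1 a' φ p.2.1 p.2.2))
    (ht : ContDiff ℝ ∞ (fun e' => t e' a' φ)) :
    ∀ a b, a + b ≤ nbar →
      iteratedDeriv a (fun e' => iteratedDeriv b (fun l' =>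
          t e' a' φ * Real.exp (-pertSum362 (Ek e' a' φ) e' l' nbar)) 0) 0
        = iteratedDeriv a (fun e' => iteratedDeriv b (fun l' =>
          t e' a' φ * Real.exp (-Ek e' a' φ e' l')) 0) 0 := by
  have hF : ContDiff ℝ ∞ (Function.uncurry fun u l => pertSum362 (Ek u a' φ) u l nbar) :=
    contDiff_pertSum362 (fun u s l => Ek u a' φ s l) hK nbar
  have hG : ContDiff ℝ ∞ (Function.uncurry fun u l => Ek u a' φ u l) :=
    hK.comp (contDiff_fst.prodMk (contDiff_fst.prodMk contDiff_snd))
  have hJ : ∀ a b, a + b ≤ nbar →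
      iteratedDeriv a (fun u => iteratedDeriv b (fun l => pertSum362 (Ek u a' φ) u l nbar) 0) 0
        = iteratedDeriv a (fun u => iteratedDeriv b (fun l => Ek u a' φ u l) 0) 0 :=
    fun a b hab => jet_taylor_diag (fun u s l => Ek u a' φ s l) hK nbar hab
  have hexp : ContDiffOn ℝ ∞ (fun x : ℝ => Real.exp (-x)) Set.univ :=
    (Real.contDiff_exp.comp contDiff_neg).contDiffOn
  have h2 := NestedJet.comp isOpen_univ hexp hF hG (fun _ _ => Set.mem_univ _)
    (fun _ _ => Set.mem_univ _) hJ
  have hH : ContDiff ℝ ∞ (Function.uncurry fun (u : ℝ) (_ : ℝ) => t u a' φ) := ht.comp contDiff_fst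
  exact NestedJet.mul hH (Real.contDiff_exp.comp hF.neg) (Real.contDiff_exp.comp hG.neg) h2

variable {V : Type*} [NormedAddCommGroup V] [InnerProductSpace ℝ V] [FiniteDimensional ℝ V]
  [MeasurableSpace V] [BorelSpace V]
variable {X Y : Type*} [Fintype X]
variable {ΩA : Type*} [MeasurableSpace ΩA]

/-- **(3.62) = (3.63), p. 624** — *"in (3.61) we can take a whole function E_k instead of its expansion until the order
n̄"*.  With `E = genFn361 quadB νA t₁ Ek n̄ ψ` ((3.61): `E(e′,λ′) = ½quadB − log ∫ T_{t₁(e′,a)}[φ ↦ exp(−Σ_{α+β≦n̄}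
(1/(α!β!)) e′^αλ′^β ∂^{α,β}E_k(0,0; e′,a,φ))](ψ) dνA(a)`) and `E′(e′,λ′) = ½quadB − log ∫ T_{t₁(e′,a)}[φ ↦ exp(−E_k(e′,λ′;
e′,a,φ))](ψ) dνA(a)` (the whole `E_k`): `Σ_{α+β≦n̄} (1/(α!β!)) e^αλ^β ∂^{α+β}E|₀ = Σ_{α+β≦n̄} (1/(α!β!)) e^αλ^β ∂^{α+β}E′|₀`,
PROVIDED (a) `hK`: `(u, s, t) ↦ E_k(s, t; u, a, φ)` is jointly `C^∞` for every `(a, φ)`; (b) `ht`: the kernel is `C^∞` in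
the coupling; (c) `hI₁, hI₂, hne₁, hne₂`: the two `dνA`-integrals are `C^∞` in `(e′, λ′)` and never vanish; (d) `hD₁, hD₂`:
for `a + b ≦ n̄`, `∂^a_{e′}∂^b_{λ′}|₀` of each integral is the `∫dνA ∫dφ` integral of `∂^a_{e′}∂^b_{λ′}|₀` of its integrand
(`B1RT.rtOp t ρ ψ = ∫ t ψ φ · ρ φ dφ`). [cite: Balaban1982Higgs1, (3.62)–(3.63) p.624] -/
theorem eq362_363 (quadB : ℝ) (νA : Measure ΩA) (t₁ : ℝ → ΩA → (Y → V) → (X → V) → ℝ)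
    (Ek : ℝ → ΩA → (X → V) → ℝ → ℝ → ℝ) (nbar : ℕ) (ψ : Y → V)
    (hK : ∀ a φ, ContDiff ℝ ∞ (fun p : ℝ × ℝ × ℝ => Ek p.1 a φ p.2.1 p.2.2))
    (ht : ∀ a φ, ContDiff ℝ ∞ (fun e' => t₁ e' a ψ φ))
    (hI₁ : ContDiff ℝ ∞ (Function.uncurry fun e' l' =>
      ∫ a, rtOp (t₁ e' a) (fun φ => Real.exp (-pertSum362 (Ek e' a φ) e' l' nbar)) ψ ∂νA))
    (hI₂ : ContDiff ℝ ∞ (Function.uncurry fun e' l' =>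
      ∫ a, rtOp (t₁ e' a) (fun φ => Real.exp (-Ek e' a φ e' l')) ψ ∂νA))
    (hne₁ : ∀ e' l',
      ∫ a, rtOp (t₁ e' a) (fun φ => Real.exp (-pertSum362 (Ek e' a φ) e' l' nbar)) ψ ∂νA ≠ 0)
    (hne₂ : ∀ e' l', ∫ a, rtOp (t₁ e' a) (fun φ => Real.exp (-Ek e' a φ e' l')) ψ ∂νA ≠ 0)
    (hD₁ : ∀ a b, a + b ≤ nbar →
      iteratedDeriv a (fun e' => iteratedDeriv b (fun l' =>
        ∫ a', rtOp (t₁ e' a') (fun φ => Real.exp (-pertSum362 (Ek e' a' φ) e' l' nbar)) ψ ∂νA) 0) 0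
      = ∫ a', (∫ φ, iteratedDeriv a (fun e' => iteratedDeriv b (fun l' =>
          t₁ e' a' ψ φ * Real.exp (-pertSum362 (Ek e' a' φ) e' l' nbar)) 0) 0) ∂νA)
    (hD₂ : ∀ a b, a + b ≤ nbar →
      iteratedDeriv a (fun e' => iteratedDeriv b (fun l' =>
        ∫ a', rtOp (t₁ e' a') (fun φ => Real.exp (-Ek e' a' φ e' l')) ψ ∂νA) 0) 0
      = ∫ a', (∫ φ, iteratedDeriv a (fun e' => iteratedDeriv b (fun l' =>
          t₁ e' a' ψ φ * Real.exp (-Ek e' a' φ e' l')) 0) 0) ∂νA)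
    (e lam : ℝ) :
    pertSum362 (genFn361 quadB νA t₁ Ek nbar ψ) e lam nbar
      = pertSum362 (fun e' l' => 1 / 2 * quadB
          - Real.log (∫ a, rtOp (t₁ e' a) (fun φ => Real.exp (-Ek e' a φ e' l')) ψ ∂νA)) e lam nbar := by
  apply pertSum362_congr_jet
  -- the nested `n̄`-jets of the two `dνA`-integrals agree (hypothesis (d) + the pointwise statement (B))
  have hI : ∀ a b, a + b ≤ nbar →
      iteratedDeriv a (fun e' => iteratedDeriv b (fun l' =>
        ∫ a', rtOp (t₁ e' a') (fun φ => Real.exp (-pertSum362 (Ek e' a' φ) e' l' nbar)) ψ ∂νA) 0) 0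
      = iteratedDeriv a (fun e' => iteratedDeriv b (fun l' =>
        ∫ a', rtOp (t₁ e' a') (fun φ => Real.exp (-Ek e' a' φ e' l')) ψ ∂νA) 0) 0 := by
    intro a b hab
    rw [hD₁ a b hab, hD₂ a b hab]
    congr 1
    funext a'
    congr 1
    funext φ
    exact integrand_jet_eq (fun e' a' φ => t₁ e' a' ψ φ) Ek nbar a' φ (hK a' φ) (ht a' φ) a b hab
  -- through `x ↦ ½quadB − log x`, smooth away from `0` (hypothesis (c))
  have hφ : ContDiffOn ℝ ∞ (fun x : ℝ => 1 / 2 * quadB - Real.log x) {0}ᶜ :=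
    contDiffOn_const.sub Real.contDiffOn_log
  have key := NestedJet.comp isOpen_compl_singleton hφ hI₁ hI₂ (fun e' l' => hne₁ e' l')
    (fun e' l' => hne₂ e' l') hI
  intro a b hab
  exact key a b hab

/-- **The printed implication (3.62) ⇒ (3.63)**: under the hypotheses of `eq362_363`, if the action is given by the
perturbative formula (3.62) for `E` of (3.61), `S^{(k+1),L^{k+1}ε}(B, ψ) = pertSum362 E e λ n̄`, then it is given by the
same formula for `E′` with the whole `E_k` — *"so S^{(k+1),L^{k+1}ε}(B, ψ) = Σ … E′ … (3.63)"*; (3.64) is this `E′` after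
substituting the definition (3.35) of `E_k` (`B1Eq365Proof.genFn335`, shape `genFn364`), and (3.65)/(3.36)_{k+1} follow by
`B1Eq365Proof.eq365_rt` and `B1Step363Proof.eq336_succ`. [cite: Balaban1982Higgs1, (3.62)–(3.64) p.624] -/
theorem eq363_of_eq362 (quadB : ℝ) (νA : Measure ΩA) (t₁ : ℝ → ΩA → (Y → V) → (X → V) → ℝ)
    (Ek : ℝ → ΩA → (X → V) → ℝ → ℝ → ℝ) (nbar : ℕ) (ψ : Y → V)
    (hK : ∀ a φ, ContDiff ℝ ∞ (fun p : ℝ × ℝ × ℝ => Ek p.1 a φ p.2.1 p.2.2))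
    (ht : ∀ a φ, ContDiff ℝ ∞ (fun e' => t₁ e' a ψ φ))
    (hI₁ : ContDiff ℝ ∞ (Function.uncurry fun e' l' =>
      ∫ a, rtOp (t₁ e' a) (fun φ => Real.exp (-pertSum362 (Ek e' a φ) e' l' nbar)) ψ ∂νA))
    (hI₂ : ContDiff ℝ ∞ (Function.uncurry fun e' l' =>
      ∫ a, rtOp (t₁ e' a) (fun φ => Real.exp (-Ek e' a φ e' l')) ψ ∂νA))
    (hne₁ : ∀ e' l',
      ∫ a, rtOp (t₁ e' a) (fun φ => Real.exp (-pertSum362 (Ek e' a φ) e' l' nbar)) ψ ∂νA ≠ 0)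
    (hne₂ : ∀ e' l', ∫ a, rtOp (t₁ e' a) (fun φ => Real.exp (-Ek e' a φ e' l')) ψ ∂νA ≠ 0)
    (hD₁ : ∀ a b, a + b ≤ nbar →
      iteratedDeriv a (fun e' => iteratedDeriv b (fun l' =>
        ∫ a', rtOp (t₁ e' a') (fun φ => Real.exp (-pertSum362 (Ek e' a' φ) e' l' nbar)) ψ ∂νA) 0) 0
      = ∫ a', (∫ φ, iteratedDeriv a (fun e' => iteratedDeriv b (fun l' =>
          t₁ e' a' ψ φ * Real.exp (-pertSum362 (Ek e' a' φ) e' l' nbar)) 0) 0) ∂νA)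
    (hD₂ : ∀ a b, a + b ≤ nbar →
      iteratedDeriv a (fun e' => iteratedDeriv b (fun l' =>
        ∫ a', rtOp (t₁ e' a') (fun φ => Real.exp (-Ek e' a' φ e' l')) ψ ∂νA) 0) 0
      = ∫ a', (∫ φ, iteratedDeriv a (fun e' => iteratedDeriv b (fun l' =>
          t₁ e' a' ψ φ * Real.exp (-Ek e' a' φ e' l')) 0) 0) ∂νA)
    {S e lam : ℝ} (h362 : S = pertSum362 (genFn361 quadB νA t₁ Ek nbar ψ) e lam nbar) :
    S = pertSum362 (fun e' l' => 1 / 2 * quadB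
          - Real.log (∫ a, rtOp (t₁ e' a) (fun φ => Real.exp (-Ek e' a φ e' l')) ψ ∂νA)) e lam nbar := by
  rw [h362]
  exact eq362_363 quadB νA t₁ Ek nbar ψ hK ht hI₁ hI₂ hne₁ hne₂ hD₁ hD₂ e lam

end Assembly

end Literature.MathematicalPhysics.QuantumFieldTheory.Balaban1983to89.B1Eq363JetProof
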